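import Literature.MathematicalPhysics.QuantumFieldTheory.Balaban1983to89.B6SectA

/-!
# `Balaban1983to89.B6Eq295` — T. Bałaban, *Propagators and renormalization transformations for lattice gauge
theories. II*, Commun. Math. Phys. **96**, 223–250 (1984) [Balaban1984PropagatorsII] (cell paper B6; held
`paper:balaban1984-cmp96-propagators-rt-ii`, journal page = PDF page + 222), **Sect. A (2.24)–(2.25) and Sect. C
(2.95)–(2.102), (2.106)**: the Gaussian (moment-generating) representations of the projection `R` and of the propagator
`G = Δ_a⁻¹`, the Faddeev–Popov factor *"(1.27) valid for this operator P also"*, and the gauge-change step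
(2.98) ⇒ (2.99) ⇒ (2.100) ⇒ (2.101) `λ = H′_jμ` with its variational characterisation (2.102) — PROVED over abstract
carriers (requested by the audit cell's NE-spine interface, register loci F-T4-368 / F-T4-378).

HONEST FRAMING (mega-formalization `lit-balaban`, reader/typer r03): statement-level skeleton of published theorems with
citation tags; proofs where landed; nothing here is a claim about the Yang–Mills mass gap.  The series' end-statement is
under adjudication by the audit cell `pub-balaban`; this module asserts nothing of it.  Quotations were read from the ×2
page renders `run/shared/lean/pub/pub-balaban/b2b-balaban-ref1/pages/1984-cmp96-propagators-rt-II/…-p004, p018, p019,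
p020-x2.png` (pp. 226, 240–242) AS IMAGES.  Imports: Mathlib and the sibling `…B6SectA` (for `deltaA` = Δ_a of (2.19)
and `hOp` = the `GQ*E` pattern of (2.35)); nothing else of the tree is touched.

WHAT THE PAPER PRINTS (verbatim).
* (2.24)–(2.26) p. 226: *"At first we will write an integral representation of the operator R, analogous to the
  representation (1.27). By the formula (2.17) and properties of Gaussian integrals we have
  e^{−½⟨f,Rf⟩} = e^{−½‖f‖²}(Z′⁻¹∫dλ δ(Q′λ) e^{−½‖f−Δλ‖²})⁻¹ (2.24) or
  e^{½⟨f,Rf⟩} = Z′⁻¹∫dλ δ(Q′λ) e^{−½‖Δλ‖² + ⟨Δf,λ⟩}. (2.25) Let us denote by 𝒢 a covariance of the Gaussian integral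
  on the right-hand side above. Thus we have R = Δ𝒢Δ. (2.26)"*  (R = the orthogonal projection of L²(T_η) onto
  ΔN(Q′), (2.10); P = I − R, (2.19).)
* (2.95) p. 240: *"To investigate the operator G we will express it in terms of known operators in a way similar to
  (2.41), (2.42). Thus we have e^{½⟨J,GJ⟩} = Z⁻¹∫dA exp[−½⟨QA,aQA⟩ − ½⟨A,(Δ−∂P∂*)A⟩ + ⟨A,J⟩]
  = Z⁻¹∫dA exp[−½⟨QA,aQA⟩ − ½⟨A,ΔA⟩ + ⟨A,J⟩] (Z′⁻¹∫dλδ(Q′λ)e^{−½‖∂*A−Δλ‖²})⁻¹ ·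
  [∫dω↾_Λδ(Q′₁ω)Π_{y∈Λ′}δ_{Ax(y)}(Q_jA+∂₁ω)Z′_j⁻¹∫dλ′δ(Q′_jλ′)e^{−½‖∂*A−Δλ′‖²}] /
  [∫dω′↾_Λδ(Q′₁ω′)Π_{y∈Λ′}δ_{Ax(y)}(Q_jA+∂₁ω′)Z′_j⁻¹∫dλ′δ(Q′_jλ′)e^{−½‖∂*A−Δλ′‖²}], (2.95)
  where we have used the identity (1.27) valid for this operator P also."*
* (2.96) p. 240: *"from the definition of δ_{Ax} we have ∫dω′↾_Λδ(Q′₁ω′)Π_{y∈Λ′}δ_{Ax(y)}(Q_jA+∂₁ω′) = 1. (2.96) Such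
  an identity was used already in the change of gauge formula (1.23)."*  — the existence-and-uniqueness content of this
  normalisation (exactly one admissible ω′ per configuration) is the tree's `…Balaban1983to89.B5.HierGauge.complete` /
  `.unique`; the unit Jacobian is not typed here.  (2.97) p. 240 is (2.95) with (2.96), (1.27) applied to the
  denominator (operator P_j); located, not retyped.
* (2.98)–(2.101) pp. 240–241: *"At first let us find gauge transformations λ which do not change the last term in the
  quadratic form, i.e. for which ‖(I−P_j)∂*A^λ‖² = ‖(I−P_j)(∂*A−Δλ)‖² = ‖(I−P_j)∂*A‖². (2.98) This equality has to
  be satisfied for all A, hence for A = 0 we get the equation (I−P_j)Δλ = 0, or Δλ = P_jΔλ. (2.99) If this equation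
  is satisfied, then the equality (2.98) holds for all A. The function Δλ is orthogonal to constant functions, hence
  P_jΔλ is given by (1.26) and we have Δλ = Δ⁻¹Q′_j*(Q′_jΔ⁻²Q′_j*)⁻¹Q′_jΔ⁻¹Δλ. (2.100) We may assume also that λ
  is orthogonal to constant functions …, hence λ = Δ⁻²Q′_j*(Q′_jΔ⁻²Q′_j*)⁻¹μ, μ = Q′_jλ. (2.101)"*
* (2.102) p. 241: *"[H′_j] gives a solution of the variational problem inf_{λ′: Q′_jλ′ = μ} ½‖Δλ′‖². Let us denote
  the operator in (2.101) by H′_j, so λ = H′_jμ."*; (2.103): *"the equality Q′_jλ = Q′_jH′_jμ = μ was used"*;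
  (2.106) p. 242: *"the second equality was obtained by the translation λ′ → λ′ + H′_jω, and the same translation
  in λ"* (no cross term survives), *"and the operator Δ′_j was defined by the second equality, Δ′_j = H′_j*Δ²H′_j.
  (2.107)"*.

HOW THE `δ`-FUNCTION INTEGRALS ARE TYPED.  `∫dλ δ(Q′λ) F(λ)` is the Lebesgue integral of `F` over the linear space
`N(Q′)` of gauge functions (2.7).  We type it as `∫ l, F (D l) ∂μ` over an abstract additive group `N` (= N(Q′))
carrying ANY left-invariant measure `μ` (Lebesgue measure on N(Q′) is one; `[μ.IsAddLeftInvariant]`) and a linear map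
`D : N →ₗ[ℝ] B` (= Δ restricted to N(Q′); `B` = the real inner-product space of scalar functions, so `ΔN(Q′)` =
`LinearMap.range D` and R = its orthogonal projection, `Submodule.starProjection`).  Likewise `∫dA …` in (2.95) is an
integral over the configuration space `A` against a left-invariant `μ`.  The identities below are proved for EVERY such
`μ`, with no integrability, injectivity or finite-dimensionality hypothesis: the only analytic inputs are translation
invariance `∫F(l₀ + l)dμ = ∫F dμ` and `∫c·F = c·∫F` (Lean's `∫` of a non-integrable function is `0`, and then both sides
vanish alike).  The printed quotient forms ((2.24) with `Z′⁻¹` and `(…)⁻¹`) are derived under `Z′ ≠ 0` (`eq224_printed`).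

CONTENTS (all `theorem`s; no definitions — `H′_j` is written `B6SectA.hOp (Δ⁻¹∘Δ⁻¹) Q′_j* E`).
§1 `integral_exp_neg_half_norm_sub_sq` (the fibre Gaussian: ∫e^{−½‖f−Dλ‖²} = e^{−½‖f−Rf‖²}·Z′), `norm_sub_starProjection_sq`,
   `eq224` / `eq224_printed` ((2.24)), `eq225` ((2.25)), `eq295_gaugeFactor` ((2.95)₂ = *"(1.27) for this operator P"*:
   e^{−½⟨A,(Δ−∂P∂*)A⟩}·∫dλδ(Q′λ)e^{−½‖∂*A−Δλ‖²} = e^{−½⟨A,ΔA⟩}·Z′, P = I − R).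
§2 `integral_exp_quadratic_add_linear` (Gaussian moment-generating function by translation A → A + GJ) and
   `eq295_first` ((2.95)₁ with the printed three-term exponent and `…B6SectA.deltaA` = Δ_a of (2.19)).
§3 `eq298_iff_eq299`, `eq2101_of_eq299` ((2.99)/(2.100) ⇒ (2.101)), `comp_hPrime_eq_id` (Q′_jH′_j = I, used at (2.103)),
   `inner_lap_sub_hPrime_eq_zero` + `norm_lap_sq_eq_add` + `hPrime_minimises` ((2.102)), `exponent_split_2106`
   (the translation step of (2.106)).
§4 (v1.1) `exponent_split_2113`, `inner_eq_zero_of_crit`, `eq2113_2114` (the translation `A → A + H_jB` of the last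
   integral of (2.112): factor (2.113) × separated integral (2.114)), `eq2116`, `eq2115` (the moment-generating function
   of the constrained Gaussian `∫dAδ(Q_jA)…` with covariance `G̃_j`), `eq2111_exponent` (the quotient of the two
   ω-integrals computed in (2.111)).
§5 (v1.2, r03 gen 3) `eq2106_regroup` (the third equality of (2.106): regrouping with Δ′_j = H′_j*Δ²H′_j (2.107)),
   `inner_deltaPrimeJ_eq_norm_sq` (⟨ω,Δ′_jω⟩ = ‖ΔH′_jω‖² ≥ 0).
Not typed here: (2.96)'s unit Jacobian, (2.97), (2.103)–(2.105), (2.107)–(2.110) (multipliers: `…B6Hprime2101`), the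
Faddeev–Popov replacement (2.117) (*"by (1.47) and (1.64)"* of [4]), (2.118)–(2.119).

(2.111)–(2.116) pp. 242–243, verbatim: *"Calculating these integrals we get
exp[−⟨H′_j*Δ∂*A, C^{(j)}_ΛH′_j*∂*J⟩ + ½⟨H′_j*∂*J, C^{(j)}_ΛH′_j*∂*J⟩] = exp[−⟨A,∂ΔH′_jC^{(j)}_ΛH′_j*∂*J⟩ + ½⟨J,∂H′_jC^{(j)}_ΛH′_j*∂*J⟩].
(2.111) This implies further e^{½⟨J,GJ⟩} = e^{½⟨J,∂H′_jC^{(j)}_ΛH′_j*∂*J⟩}Z⁻¹Z′_j⁻¹Z′ · ∫dB exp[…]Π_{y∈Λ′}δ_{Ax(y)}(B) ·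
∫dAδ(Q_jA−B)exp[−½⟨A,(Δ−∂P_j∂*)A⟩ + ⟨A, J − ∂ΔH′_jC^{(j)}_ΛH′_j*∂*J⟩]. (2.112) In the last integral above we make the
translation A → A + H_jB. … The translation gives the factor exp[−½⟨H_jB,(Δ−∂P_j∂*)H_jB⟩ + ⟨H_jB, J − ∂ΔH′_jC^{(j)}_ΛH′_j*∂*J⟩]
(2.113) and separates the integral over A: ∫dAδ(Q_jA)exp[−½⟨A,(Δ−∂P_j∂*)A⟩ + ⟨A, J − …⟩]. (2.114) Let us denote a covariance
of this Gaussian integral by G̃_j, then the integral is equal to Z̃_j exp[½⟨J − …, G̃_j(J − …)⟩]. (2.115) Let us notice also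
that exp[−½⟨H_jB,(Δ−∂P_j∂*)H_jB⟩] = Z̃_j⁻¹∫dAδ(Q_jA−B)exp[−½⟨A,(Δ−∂P_j∂*)A⟩], (2.116)"*.  The fibre integral
`∫dA δ(Q_jA − B) F(A)` is typed as `∫ n, F (ι n + h) ∂μ` with `ι : N →ₗ[ℝ] A` parametrising `{Q_jA = 0}` and `h = H_jB` a
point of the fibre (the translation of the text); the only input about `H_j` is the critical-point property
`(Δ−∂P_j∂*)H_jB ⊥ {Q_jA = 0}` (`hcrit`; from `(Δ−∂P_j∂*)H_jB = Q_j*ω`, `inner_eq_zero_of_crit`), and about `G̃_j` that it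
ranges in `{Q_jA = 0}` and inverts the form there (`hGt`, `hsol`).
-/

noncomputable section

open MeasureTheory
open scoped InnerProductSpace

namespace Literature.MathematicalPhysics.QuantumFieldTheory.Balaban1983to89.B6Eq295

/-! ## §1  Gaussian integrals over the gauge subspace: (2.24)–(2.25) and the factor "(1.27)" of (2.95) -/

section Fibre

variable {N : Type*} [AddCommGroup N] [Module ℝ N] [MeasurableSpace N] [MeasurableAdd N]
variable {B : Type*} [NormedAddCommGroup B] [InnerProductSpace ℝ B]

/-- `‖f − Rf‖² = ‖f‖² − ⟨f,Rf⟩` for the orthogonal projection `R` onto a subspace `K` (Pythagoras; the step behind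
*"by … properties of Gaussian integrals"* of (2.24)). [folklore] -/
private theorem norm_sub_starProjection_sq (K : Submodule ℝ B) [K.HasOrthogonalProjection] (f : B) :
    ‖f - K.starProjection f‖ ^ 2 = ‖f‖ ^ 2 - ⟪f, K.starProjection f⟫_ℝ := by
  have h0 : ⟪f - K.starProjection f, K.starProjection f⟫_ℝ = 0 :=
    Submodule.starProjection_inner_eq_zero f _ (K.starProjection_apply_mem f)
  rw [← real_inner_self_eq_norm_sq, inner_sub_right, h0, sub_zero, inner_sub_left, real_inner_self_eq_norm_sq,
    real_inner_comm]

/-- **The fibre Gaussian integral** (the computation behind (1.27) of [4] = B5 and (2.24) here): for every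
left-invariant measure `μ` on the gauge space `N` (= N(Q′)), every linear `D : N → B` (= Δ on N(Q′)) whose range
`K = ΔN(Q′)` admits an orthogonal projection `R`, and every `f`,
`∫dλ δ(Q′λ) e^{−½‖f−Δλ‖²} = e^{−½‖f − Rf‖²} · Z′`, `Z′ = ∫dλ δ(Q′λ) e^{−½‖Δλ‖²}`
(translate λ by a preimage λ₀ of Rf and split ‖(f − Rf) − Δλ‖² by Pythagoras).  No integrability hypothesis.
[cite: Balaban1984PropagatorsII, (2.24) p.226] -/
theorem integral_exp_neg_half_norm_sub_sq (μ : Measure N) [μ.IsAddLeftInvariant] (D : N →ₗ[ℝ] B)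
    (K : Submodule ℝ B) [K.HasOrthogonalProjection] (hK : LinearMap.range D = K) (f : B) :
    ∫ l, Real.exp (-(1 / 2) * ‖f - D l‖ ^ 2) ∂μ =
      Real.exp (-(1 / 2) * ‖f - K.starProjection f‖ ^ 2) * ∫ l, Real.exp (-(1 / 2) * ‖D l‖ ^ 2) ∂μ := by
  obtain ⟨l₀, hl₀⟩ : ∃ l₀, D l₀ = K.starProjection f := by
    have hmem : K.starProjection f ∈ LinearMap.range D := hK ▸ K.starProjection_apply_mem f
    exact LinearMap.mem_range.mp hmem
  have hpt : ∀ l, ‖f - D (l₀ + l)‖ ^ 2 = ‖f - K.starProjection f‖ ^ 2 + ‖D l‖ ^ 2 := by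
    intro l
    have hDl : D l ∈ K := hK ▸ LinearMap.mem_range_self D l
    have horth : ⟪f - K.starProjection f, D l⟫_ℝ = 0 := Submodule.starProjection_inner_eq_zero f _ hDl
    have h := norm_sub_sq_eq_norm_sq_add_norm_sq_real horth
    have hx : f - D (l₀ + l) = (f - K.starProjection f) - D l := by rw [map_add, hl₀]; abel
    rw [hx, sq, sq, sq, h]
  have hfun : (fun l => Real.exp (-(1 / 2) * ‖f - D (l₀ + l)‖ ^ 2)) =
      fun l => Real.exp (-(1 / 2) * ‖f - K.starProjection f‖ ^ 2) * Real.exp (-(1 / 2) * ‖D l‖ ^ 2) := by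
    funext l
    rw [hpt l, mul_add, Real.exp_add]
  calc ∫ l, Real.exp (-(1 / 2) * ‖f - D l‖ ^ 2) ∂μ
      = ∫ l, Real.exp (-(1 / 2) * ‖f - D (l₀ + l)‖ ^ 2) ∂μ :=
        (integral_add_left_eq_self (fun l => Real.exp (-(1 / 2) * ‖f - D l‖ ^ 2)) l₀).symm
    _ = Real.exp (-(1 / 2) * ‖f - K.starProjection f‖ ^ 2) * ∫ l, Real.exp (-(1 / 2) * ‖D l‖ ^ 2) ∂μ := by
        rw [hfun, integral_const_mul]

/-- **(2.24), multiplicative form (no division):** with `R` the orthogonal projection onto `ΔN(Q′) = range D`,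
`e^{−½‖f‖²} · Z′ = e^{−½⟨f,Rf⟩} · ∫dλ δ(Q′λ) e^{−½‖f−Δλ‖²}`.  *"By the formula (2.17) and properties of Gaussian
integrals we have e^{−½⟨f,Rf⟩} = e^{−½‖f‖²}(Z′⁻¹∫dλδ(Q′λ)e^{−½‖f−Δλ‖²})⁻¹ (2.24)"*.
[cite: Balaban1984PropagatorsII, (2.24) p.226] -/
theorem eq224 (μ : Measure N) [μ.IsAddLeftInvariant] (D : N →ₗ[ℝ] B) (K : Submodule ℝ B)
    [K.HasOrthogonalProjection] (hK : LinearMap.range D = K) (Rp : B →ₗ[ℝ] B)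
    (hR : ∀ g, Rp g = K.starProjection g) (f : B) :
    Real.exp (-(1 / 2) * ‖f‖ ^ 2) * ∫ l, Real.exp (-(1 / 2) * ‖D l‖ ^ 2) ∂μ =
      Real.exp (-(1 / 2) * ⟪f, Rp f⟫_ℝ) * ∫ l, Real.exp (-(1 / 2) * ‖f - D l‖ ^ 2) ∂μ := by
  rw [integral_exp_neg_half_norm_sub_sq μ D K hK f, ← mul_assoc, ← Real.exp_add, norm_sub_starProjection_sq, hR]
  congr 2
  ring

/-- **(2.24) as printed** (quotient form), under `Z′ ≠ 0`:
`e^{−½⟨f,Rf⟩} = e^{−½‖f‖²} (Z′⁻¹ ∫dλ δ(Q′λ) e^{−½‖f−Δλ‖²})⁻¹`. [cite: Balaban1984PropagatorsII, (2.24) p.226] -/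
theorem eq224_printed (μ : Measure N) [μ.IsAddLeftInvariant] (D : N →ₗ[ℝ] B) (K : Submodule ℝ B)
    [K.HasOrthogonalProjection] (hK : LinearMap.range D = K) (Rp : B →ₗ[ℝ] B)
    (hR : ∀ g, Rp g = K.starProjection g) (f : B)
    (hZ : ∫ l, Real.exp (-(1 / 2) * ‖D l‖ ^ 2) ∂μ ≠ 0) :
    Real.exp (-(1 / 2) * ⟪f, Rp f⟫_ℝ) =
      Real.exp (-(1 / 2) * ‖f‖ ^ 2) *
        ((∫ l, Real.exp (-(1 / 2) * ‖D l‖ ^ 2) ∂μ)⁻¹ * ∫ l, Real.exp (-(1 / 2) * ‖f - D l‖ ^ 2) ∂μ)⁻¹ := by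
  have hI : ∫ l, Real.exp (-(1 / 2) * ‖f - D l‖ ^ 2) ∂μ ≠ 0 := by
    rw [integral_exp_neg_half_norm_sub_sq μ D K hK f]
    exact mul_ne_zero (Real.exp_ne_zero _) hZ
  have h := eq224 μ D K hK Rp hR f
  rw [mul_inv, inv_inv, eq_comm, ← mul_assoc, mul_inv_eq_iff_eq_mul₀ hI]
  exact h

/-- **(2.25):** `Z′⁻¹ ∫dλ δ(Q′λ) e^{−½‖Δλ‖² + ⟨Δf,λ⟩} = e^{½⟨f,Rf⟩}`, multiplicative form; the printed `⟨Δf,λ⟩` is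
`⟨f,Δλ⟩ = ⟪f, D λ⟫` (Δ symmetric).  *"or e^{½⟨f,Rf⟩} = Z′⁻¹∫dλδ(Q′λ)e^{−½‖Δλ‖²+⟨Δf,λ⟩}. (2.25) Let us denote by 𝒢
a covariance of the Gaussian integral on the right-hand side above. Thus we have R = Δ𝒢Δ. (2.26)"* (the algebraic
characterisation of 𝒢 is `…B6SectA.eq_calG_of_covariance`). [cite: Balaban1984PropagatorsII, (2.25) p.226] -/
theorem eq225 (μ : Measure N) [μ.IsAddLeftInvariant] (D : N →ₗ[ℝ] B) (K : Submodule ℝ B)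
    [K.HasOrthogonalProjection] (hK : LinearMap.range D = K) (Rp : B →ₗ[ℝ] B)
    (hR : ∀ g, Rp g = K.starProjection g) (f : B) :
    ∫ l, Real.exp (-(1 / 2) * ‖D l‖ ^ 2 + ⟪f, D l⟫_ℝ) ∂μ =
      Real.exp ((1 / 2) * ⟪f, Rp f⟫_ℝ) * ∫ l, Real.exp (-(1 / 2) * ‖D l‖ ^ 2) ∂μ := by
  have hfun : (fun l => Real.exp (-(1 / 2) * ‖D l‖ ^ 2 + ⟪f, D l⟫_ℝ)) =
      fun l => Real.exp ((1 / 2) * ‖f‖ ^ 2) * Real.exp (-(1 / 2) * ‖f - D l‖ ^ 2) := by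
    funext l
    rw [← Real.exp_add, norm_sub_sq_real]
    congr 1
    ring
  rw [hfun, integral_const_mul, integral_exp_neg_half_norm_sub_sq μ D K hK f, ← mul_assoc, ← Real.exp_add,
    norm_sub_starProjection_sq, hR]
  congr 2
  ring

/-- **(2.95), second equality — *"the identity (1.27) valid for this operator P also"*:** with `P = I − R` on scalar
functions (`R` = orthogonal projection onto `ΔN(Q′) = range D`) and `∂*` the adjoint of `∂`,
`e^{−½⟨A,(Δ−∂P∂*)A⟩} · ∫dλ δ(Q′λ) e^{−½‖∂*A−Δλ‖²} = e^{−½⟨A,ΔA⟩} · Z′`, i.e.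
`e^{−½⟨A,(Δ−∂P∂*)A⟩} = e^{−½⟨A,ΔA⟩} (Z′⁻¹∫dλδ(Q′λ)e^{−½‖∂*A−Δλ‖²})⁻¹` — the pointwise rewriting of the integrand that
turns the first line of (2.95) into the second. [cite: Balaban1984PropagatorsII, (2.95) p.240] -/
theorem eq295_gaugeFactor (μ : Measure N) [μ.IsAddLeftInvariant] (D : N →ₗ[ℝ] B) (K : Submodule ℝ B)
    [K.HasOrthogonalProjection] (hK : LinearMap.range D = K)
    {A : Type*} [NormedAddCommGroup A] [InnerProductSpace ℝ A]
    (lap : A →ₗ[ℝ] A) (d : B →ₗ[ℝ] A) (dstar : A →ₗ[ℝ] B) (P : B →ₗ[ℝ] B)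
    (hadj : ∀ (a : A) (g : B), ⟪a, d g⟫_ℝ = ⟪dstar a, g⟫_ℝ) (hP : ∀ g, P g = g - K.starProjection g) (a : A) :
    Real.exp (-(1 / 2) * ⟪a, (lap - d ∘ₗ P ∘ₗ dstar) a⟫_ℝ) *
        ∫ l, Real.exp (-(1 / 2) * ‖dstar a - D l‖ ^ 2) ∂μ =
      Real.exp (-(1 / 2) * ⟪a, lap a⟫_ℝ) * ∫ l, Real.exp (-(1 / 2) * ‖D l‖ ^ 2) ∂μ := by
  have hquad : ⟪a, (lap - d ∘ₗ P ∘ₗ dstar) a⟫_ℝ =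
      ⟪a, lap a⟫_ℝ - (‖dstar a‖ ^ 2 - ⟪dstar a, K.starProjection (dstar a)⟫_ℝ) := by
    simp only [LinearMap.sub_apply, LinearMap.comp_apply, inner_sub_right, hadj, hP, real_inner_self_eq_norm_sq]
  rw [hquad, integral_exp_neg_half_norm_sub_sq μ D K hK (dstar a), ← mul_assoc, ← Real.exp_add,
    norm_sub_starProjection_sq]
  congr 2
  ring

end Fibre

/-! ## §2  The Gaussian representation of `G = Δ_a⁻¹`: (2.95), first equality -/

section Source

variable {A : Type*} [NormedAddCommGroup A] [InnerProductSpace ℝ A] [MeasurableSpace A] [MeasurableAdd A]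

/-- **Gaussian moment-generating function by translation.**  For a left-invariant measure `μ` on `A`, a symmetric
`M` and `G` with `MG = I`:  `∫ e^{−½⟨A,MA⟩ + ⟨A,J⟩} dμ(A) = e^{½⟨J,GJ⟩} ∫ e^{−½⟨A,MA⟩} dμ(A)` (substitute
A → A + GJ).  No positivity or integrability hypothesis (both sides are `0` when the Gaussian is not integrable).
This is the first equality of (2.95) (there `M = Δ_a`, `G = Δ_a⁻¹`; printed form: `eq295_first`) and the mechanism of
the translations (2.113)–(2.115). [cite: Balaban1984PropagatorsII, (2.95) p.240] -/
theorem integral_exp_quadratic_add_linear (μ : Measure A) [μ.IsAddLeftInvariant] (M G : A →ₗ[ℝ] A)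
    (hM : ∀ x y : A, ⟪M x, y⟫_ℝ = ⟪x, M y⟫_ℝ) (hMG : M ∘ₗ G = LinearMap.id) (J : A) :
    ∫ a, Real.exp (-(1 / 2) * ⟪a, M a⟫_ℝ + ⟪a, J⟫_ℝ) ∂μ =
      Real.exp ((1 / 2) * ⟪J, G J⟫_ℝ) * ∫ a, Real.exp (-(1 / 2) * ⟪a, M a⟫_ℝ) ∂μ := by
  have hGJ : M (G J) = J := by simpa using LinearMap.congr_fun hMG J
  have hcross : ∀ b : A, ⟪G J, M b⟫_ℝ = ⟪b, J⟫_ℝ := fun b => by rw [← hM, hGJ, real_inner_comm]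
  have hkey : ∀ b : A, -(1 / 2) * ⟪G J + b, M (G J + b)⟫_ℝ + ⟪G J + b, J⟫_ℝ =
      (1 / 2) * ⟪J, G J⟫_ℝ + -(1 / 2) * ⟪b, M b⟫_ℝ := by
    intro b
    rw [map_add, hGJ, inner_add_left, inner_add_right, inner_add_right, hcross, inner_add_left,
      real_inner_comm J (G J)]
    ring
  have hfun : (fun b => Real.exp (-(1 / 2) * ⟪G J + b, M (G J + b)⟫_ℝ + ⟪G J + b, J⟫_ℝ)) =
      fun b => Real.exp ((1 / 2) * ⟪J, G J⟫_ℝ) * Real.exp (-(1 / 2) * ⟪b, M b⟫_ℝ) := by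
    funext b
    rw [hkey, Real.exp_add]
  calc ∫ a, Real.exp (-(1 / 2) * ⟪a, M a⟫_ℝ + ⟪a, J⟫_ℝ) ∂μ
      = ∫ b, Real.exp (-(1 / 2) * ⟪G J + b, M (G J + b)⟫_ℝ + ⟪G J + b, J⟫_ℝ) ∂μ :=
        (integral_add_left_eq_self (fun a => Real.exp (-(1 / 2) * ⟪a, M a⟫_ℝ + ⟪a, J⟫_ℝ)) (G J)).symm
    _ = Real.exp ((1 / 2) * ⟪J, G J⟫_ℝ) * ∫ a, Real.exp (-(1 / 2) * ⟪a, M a⟫_ℝ) ∂μ := by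
        rw [hfun, integral_const_mul]

variable {B W : Type*} [NormedAddCommGroup B] [InnerProductSpace ℝ B] [NormedAddCommGroup W]
  [InnerProductSpace ℝ W]

/-- **(2.95), first equality, with the printed three-term exponent:**
`Z · e^{½⟨J,GJ⟩} = ∫dA exp[−½⟨QA,aQA⟩ − ½⟨A,(Δ−∂P∂*)A⟩ + ⟨A,J⟩]`, `Z = ∫dA exp[−½⟨QA,aQA⟩ − ½⟨A,(Δ−∂P∂*)A⟩]`,
for `G` a right inverse of the symmetric operator `Δ_a = Δ − ∂P∂* + Q*aQ` of (2.19) (`…B6SectA.deltaA`; (2.22):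
`G = Δ_a⁻¹`) and `Q*` the adjoint of `Q`.  *"e^{½⟨J,GJ⟩} = Z⁻¹∫dA exp[−½⟨QA,aQA⟩ − ½⟨A,(Δ−∂P∂*)A⟩ + ⟨A,J⟩]"*.
[cite: Balaban1984PropagatorsII, (2.95) p.240] -/
theorem eq295_first (μ : Measure A) [μ.IsAddLeftInvariant] (lap G : A →ₗ[ℝ] A) (d : B →ₗ[ℝ] A)
    (dstar : A →ₗ[ℝ] B) (P : B →ₗ[ℝ] B) (Q : A →ₗ[ℝ] W) (Qs : W →ₗ[ℝ] A) (a : W →ₗ[ℝ] W)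
    (hQ : ∀ (w : W) (v : A), ⟪Qs w, v⟫_ℝ = ⟪w, Q v⟫_ℝ)
    (hsym : ∀ x y : A, ⟪B6SectA.deltaA lap d dstar P Q Qs a x, y⟫_ℝ = ⟪x, B6SectA.deltaA lap d dstar P Q Qs a y⟫_ℝ)
    (hG : B6SectA.deltaA lap d dstar P Q Qs a ∘ₗ G = LinearMap.id) (J : A) :
    ∫ v, Real.exp (-(1 / 2) * ⟪Q v, a (Q v)⟫_ℝ - (1 / 2) * ⟪v, (lap - d ∘ₗ P ∘ₗ dstar) v⟫_ℝ + ⟪v, J⟫_ℝ) ∂μ =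
      Real.exp ((1 / 2) * ⟪J, G J⟫_ℝ) *
        ∫ v, Real.exp (-(1 / 2) * ⟪Q v, a (Q v)⟫_ℝ - (1 / 2) * ⟪v, (lap - d ∘ₗ P ∘ₗ dstar) v⟫_ℝ) ∂μ := by
  have hexp : ∀ v : A, -(1 / 2) * ⟪Q v, a (Q v)⟫_ℝ - (1 / 2) * ⟪v, (lap - d ∘ₗ P ∘ₗ dstar) v⟫_ℝ =
      -(1 / 2) * ⟪v, B6SectA.deltaA lap d dstar P Q Qs a v⟫_ℝ := by
    intro v
    have h1 : ⟪Q v, a (Q v)⟫_ℝ = ⟪v, Qs (a (Q v))⟫_ℝ := by rw [real_inner_comm, ← hQ, real_inner_comm]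
    simp only [B6SectA.deltaA, LinearMap.sub_apply, LinearMap.add_apply, LinearMap.comp_apply, inner_sub_right,
      inner_add_right, h1]
    ring
  have hf1 : (fun v : A => Real.exp (-(1 / 2) * ⟪Q v, a (Q v)⟫_ℝ -
      (1 / 2) * ⟪v, (lap - d ∘ₗ P ∘ₗ dstar) v⟫_ℝ + ⟪v, J⟫_ℝ)) =
      fun v => Real.exp (-(1 / 2) * ⟪v, B6SectA.deltaA lap d dstar P Q Qs a v⟫_ℝ + ⟪v, J⟫_ℝ) := by
    funext v; rw [hexp]
  have hf2 : (fun v : A => Real.exp (-(1 / 2) * ⟪Q v, a (Q v)⟫_ℝ -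
      (1 / 2) * ⟪v, (lap - d ∘ₗ P ∘ₗ dstar) v⟫_ℝ)) =
      fun v => Real.exp (-(1 / 2) * ⟪v, B6SectA.deltaA lap d dstar P Q Qs a v⟫_ℝ) := by
    funext v; rw [hexp]
  rw [hf1, hf2]
  exact integral_exp_quadratic_add_linear μ _ G hsym hG J

end Source

/-! ## §3  The gauge-change step (2.98)–(2.102) and the translation of (2.106) -/

section GaugeChange

/-- **(2.98) ⇔ (2.99):** for a linear `T` (= I − P_j), `∂*` and `u` (= Δλ),
`(∀ A, ‖T(∂*A − u)‖² = ‖T∂*A‖²) ↔ Tu = 0`.  *"This equality has to be satisfied for all A, hence for A = 0 we get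
the equation (I−P_j)Δλ = 0 … (2.99) If this equation is satisfied, then the equality (2.98) holds for all A."*
[cite: Balaban1984PropagatorsII, (2.98)–(2.99) p.240] -/
theorem eq298_iff_eq299 {A B : Type*} [AddCommGroup A] [Module ℝ A] [NormedAddCommGroup B] [Module ℝ B]
    (T : B →ₗ[ℝ] B) (dstar : A →ₗ[ℝ] B) (u : B) :
    (∀ v : A, ‖T (dstar v - u)‖ ^ 2 = ‖T (dstar v)‖ ^ 2) ↔ T u = 0 := by
  constructor
  · intro h
    have h0 := h 0
    rw [map_zero, zero_sub, map_neg, norm_neg, map_zero, norm_zero] at h0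
    simpa using h0
  · intro hT v
    rw [map_sub, hT, sub_zero]

variable {R : Type*} [CommRing R]
variable {B W : Type*} [AddCommGroup B] [Module R B] [AddCommGroup W] [Module R W]

/-! `H′_j := Δ⁻²Q′_j*(Q′_jΔ⁻²Q′_j*)⁻¹` of (2.101) is written `B6SectA.hOp (Dinv ∘ₗ Dinv) Qps E` — the `GQ*E` pattern of
(2.35)/(1.103) with `G = Δ⁻¹Δ⁻¹` (`Dinv` = Δ⁻¹ on functions orthogonal to constants, `Qps` = Q′_j*, `E` = the inverse
of `Q′_jΔ⁻²Q′_j*`); *"Let us denote the operator in (2.101) by H′_j, so λ = H′_jμ"* (p. 241).  No new definition. -/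

/-- **(2.99)/(2.100) ⇒ (2.101):** if `Δλ = P_jΔλ` with `P_j = Δ⁻¹Q′_j*EQ′_jΔ⁻¹` ((1.26) of [4]; *"The function Δλ is
orthogonal to constant functions, hence P_jΔλ is given by (1.26)"*) and `Δ⁻¹Δ = I` on the functions considered
(*"We may assume also that λ is orthogonal to constant functions"*), then `λ = H′_j(Q′_jλ)`:
*"λ = Δ⁻²Q′_j*(Q′_jΔ⁻²Q′_j*)⁻¹μ, μ = Q′_jλ. (2.101)"* [cite: Balaban1984PropagatorsII, (2.99)–(2.101) pp.240–241] -/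
theorem eq2101_of_eq299 (lap Dinv : B →ₗ[R] B) (Qp : B →ₗ[R] W) (Qps : W →ₗ[R] B) (E : W →ₗ[R] W)
    (hinv : Dinv ∘ₗ lap = LinearMap.id) (l : B)
    (h299 : lap l = (Dinv ∘ₗ Qps ∘ₗ E ∘ₗ Qp ∘ₗ Dinv) (lap l)) :
    l = B6SectA.hOp (Dinv ∘ₗ Dinv) Qps E (Qp l) := by
  have h1 : ∀ x, Dinv (lap x) = x := fun x => by simpa using LinearMap.congr_fun hinv x
  have h2 := congrArg Dinv h299
  simp only [LinearMap.comp_apply, h1] at h2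
  simpa [B6SectA.hOp] using h2

/-- `Q′_jH′_j = I` (*"where the equality Q′_jλ = Q′_jH′_jμ = μ was used"*, (2.103)), `E` a right inverse of
`Q′_jΔ⁻²Q′_j*`. [cite: Balaban1984PropagatorsII, (2.103) p.241] -/
theorem comp_hPrime_eq_id (Dinv : B →ₗ[R] B) (Qp : B →ₗ[R] W) (Qps : W →ₗ[R] B) (E : W →ₗ[R] W)
    (hE : (Qp ∘ₗ (Dinv ∘ₗ Dinv) ∘ₗ Qps) ∘ₗ E = LinearMap.id) :
    Qp ∘ₗ B6SectA.hOp (Dinv ∘ₗ Dinv) Qps E = LinearMap.id := by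
  rw [← hE]
  simp only [B6SectA.hOp, LinearMap.comp_assoc]

end GaugeChange

section Variational

variable {B W : Type*} [NormedAddCommGroup B] [InnerProductSpace ℝ B] [NormedAddCommGroup W]
  [InnerProductSpace ℝ W]

/-- The orthogonality behind (2.102) and the translation of (2.106): for `Δ` symmetric with `ΔΔ⁻¹ = I`, `Q′_j*` the
adjoint of `Q′_j`, `E` a right inverse of `Q′_jΔ⁻²Q′_j*`, and any `λ′` with `Q′_jλ′ = Q′_j(H′_jμ)` (= μ):
`⟨Δ(λ′ − H′_jμ), ΔH′_jμ⟩ = 0` (since `Δ²H′_jμ = Q′_j*Eμ`). [cite: Balaban1984PropagatorsII, (2.102) p.241] -/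
theorem inner_lap_sub_hPrime_eq_zero (lap Dinv : B →ₗ[ℝ] B) (Qp : B →ₗ[ℝ] W) (Qps : W →ₗ[ℝ] B)
    (E : W →ₗ[ℝ] W) (hlap : ∀ x y : B, ⟪lap x, y⟫_ℝ = ⟪x, lap y⟫_ℝ)
    (hadj : ∀ (w : W) (v : B), ⟪Qps w, v⟫_ℝ = ⟪w, Qp v⟫_ℝ) (hinv : lap ∘ₗ Dinv = LinearMap.id)
    (m : W) (l' : B) (hl' : Qp l' = Qp (B6SectA.hOp (Dinv ∘ₗ Dinv) Qps E m)) :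
    ⟪lap (l' - B6SectA.hOp (Dinv ∘ₗ Dinv) Qps E m), lap (B6SectA.hOp (Dinv ∘ₗ Dinv) Qps E m)⟫_ℝ = 0 := by
  have h1 : ∀ x, lap (Dinv x) = x := fun x => by simpa using LinearMap.congr_fun hinv x
  have h2 : lap (lap (B6SectA.hOp (Dinv ∘ₗ Dinv) Qps E m)) = Qps (E m) := by simp [B6SectA.hOp, h1]
  have hQ : Qp (l' - B6SectA.hOp (Dinv ∘ₗ Dinv) Qps E m) = 0 := by rw [map_sub, hl', sub_self]
  rw [hlap, h2, real_inner_comm, hadj, hQ, inner_zero_right]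

/-- Pythagoras for (2.102)/(2.106): under the hypotheses of `inner_lap_sub_hPrime_eq_zero`,
`‖Δλ′‖² = ‖ΔH′_jμ‖² + ‖Δ(λ′ − H′_jμ)‖²`. [cite: Balaban1984PropagatorsII, (2.102) p.241] -/
theorem norm_lap_sq_eq_add (lap Dinv : B →ₗ[ℝ] B) (Qp : B →ₗ[ℝ] W) (Qps : W →ₗ[ℝ] B) (E : W →ₗ[ℝ] W)
    (hlap : ∀ x y : B, ⟪lap x, y⟫_ℝ = ⟪x, lap y⟫_ℝ) (hadj : ∀ (w : W) (v : B), ⟪Qps w, v⟫_ℝ = ⟪w, Qp v⟫_ℝ)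
    (hinv : lap ∘ₗ Dinv = LinearMap.id) (m : W) (l' : B) (hl' : Qp l' = Qp (B6SectA.hOp (Dinv ∘ₗ Dinv) Qps E m)) :
    ‖lap l'‖ ^ 2 = ‖lap (B6SectA.hOp (Dinv ∘ₗ Dinv) Qps E m)‖ ^ 2 + ‖lap (l' - B6SectA.hOp (Dinv ∘ₗ Dinv) Qps E m)‖ ^ 2 := by
  have h0 : ⟪lap (B6SectA.hOp (Dinv ∘ₗ Dinv) Qps E m), lap (l' - B6SectA.hOp (Dinv ∘ₗ Dinv) Qps E m)⟫_ℝ = 0 := by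
    rw [real_inner_comm]; exact inner_lap_sub_hPrime_eq_zero lap Dinv Qp Qps E hlap hadj hinv m l' hl'
  have h := norm_add_sq_eq_norm_sq_add_norm_sq_of_inner_eq_zero _ _ h0
  have hx : lap (B6SectA.hOp (Dinv ∘ₗ Dinv) Qps E m) + lap (l' - B6SectA.hOp (Dinv ∘ₗ Dinv) Qps E m) = lap l' := by rw [map_sub]; abel
  rw [hx] at h
  rw [sq, sq, sq, h]

/-- **(2.102): `H′_j` solves the variational problem** `inf_{λ′ : Q′_jλ′ = μ} ½‖Δλ′‖²`: every competitor `λ′` with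
`Q′_jλ′ = μ` has `‖ΔH′_jμ‖² ≤ ‖Δλ′‖²` (and `Q′_jH′_jμ = μ` by `comp_hPrime_eq_id`).  *"It gives a solution of the
variational problem inf_{λ′:Q′_jλ′=μ} ½‖Δλ′‖²."* [cite: Balaban1984PropagatorsII, (2.102) p.241] -/
theorem hPrime_minimises (lap Dinv : B →ₗ[ℝ] B) (Qp : B →ₗ[ℝ] W) (Qps : W →ₗ[ℝ] B) (E : W →ₗ[ℝ] W)
    (hlap : ∀ x y : B, ⟪lap x, y⟫_ℝ = ⟪x, lap y⟫_ℝ) (hadj : ∀ (w : W) (v : B), ⟪Qps w, v⟫_ℝ = ⟪w, Qp v⟫_ℝ)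
    (hinv : lap ∘ₗ Dinv = LinearMap.id) (hE : (Qp ∘ₗ (Dinv ∘ₗ Dinv) ∘ₗ Qps) ∘ₗ E = LinearMap.id)
    (m : W) (l' : B) (hl' : Qp l' = m) :
    ‖lap (B6SectA.hOp (Dinv ∘ₗ Dinv) Qps E m)‖ ^ 2 ≤ ‖lap l'‖ ^ 2 := by
  have hQH : Qp (B6SectA.hOp (Dinv ∘ₗ Dinv) Qps E m) = m := by
    simpa using LinearMap.congr_fun (comp_hPrime_eq_id Dinv Qp Qps E hE) m
  rw [norm_lap_sq_eq_add lap Dinv Qp Qps E hlap hadj hinv m l' (hl'.trans hQH.symm)]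
  exact le_add_of_nonneg_right (sq_nonneg _)

/-- **The translation step of (2.106):** for `λ′` with `Q′_jλ′ = 0` (the `δ(Q′_jλ′)` after the translation
`λ′ → λ′ + H′_jω`) the exponent splits with no cross term:
`−½‖Δ(λ′ + H′_jω)‖² + ⟨Δ(λ′ + H′_jω), ∂*A⟩ = (−½‖ΔH′_jω‖² + ⟨ΔH′_jω, ∂*A⟩) + (−½‖Δλ′‖² + ⟨Δλ′, ∂*A⟩)`
(*"the second equality was obtained by the translation λ′ → λ′ + H′_jω, and the same translation in λ"*; `‖ΔH′_jω‖² =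
⟨ω, Δ′_jω⟩`, `Δ′_j = H′_j*Δ²H′_j` (2.107)). [cite: Balaban1984PropagatorsII, (2.106)–(2.107) p.242] -/
theorem exponent_split_2106 (lap Dinv : B →ₗ[ℝ] B) (Qp : B →ₗ[ℝ] W) (Qps : W →ₗ[ℝ] B) (E : W →ₗ[ℝ] W)
    (hlap : ∀ x y : B, ⟪lap x, y⟫_ℝ = ⟪x, lap y⟫_ℝ) (hadj : ∀ (w : W) (v : B), ⟪Qps w, v⟫_ℝ = ⟪w, Qp v⟫_ℝ)
    (hinv : lap ∘ₗ Dinv = LinearMap.id) (ω : W) (l' g : B) (hl' : Qp l' = 0) :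
    -(1 / 2) * ‖lap (l' + B6SectA.hOp (Dinv ∘ₗ Dinv) Qps E ω)‖ ^ 2 + ⟪lap (l' + B6SectA.hOp (Dinv ∘ₗ Dinv) Qps E ω), g⟫_ℝ =
      (-(1 / 2) * ‖lap (B6SectA.hOp (Dinv ∘ₗ Dinv) Qps E ω)‖ ^ 2 + ⟪lap (B6SectA.hOp (Dinv ∘ₗ Dinv) Qps E ω), g⟫_ℝ) +
        (-(1 / 2) * ‖lap l'‖ ^ 2 + ⟪lap l', g⟫_ℝ) := by
  set h := B6SectA.hOp (Dinv ∘ₗ Dinv) Qps E ω with hh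
  have hQ : Qp (l' + h) = Qp h := by rw [map_add, hl', zero_add]
  have hsplit := norm_lap_sq_eq_add lap Dinv Qp Qps E hlap hadj hinv ω (l' + h) hQ
  have hsub : l' + h - h = l' := add_sub_cancel_right l' h
  rw [hsub] at hsplit
  rw [hsplit, map_add, inner_add_left]
  ring

end Variational

/-! ## §4  The translation `A → A + H_jB` of (2.112)–(2.116) and the computation (2.111)  (v1.1) -/

section Translation

variable {A W : Type*} [NormedAddCommGroup A] [InnerProductSpace ℝ A]

/-- The critical-point property behind (2.113)–(2.116): if `M h = Q*ω` (`h = H_jB` the critical configuration of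
`½⟨A,MA⟩` on `{Q_jA = B}`, `Q*` the adjoint of `Q_j`) then `⟨v, Mh⟩ = 0` for every `v` with `Q_jv = 0`.
[cite: Balaban1984PropagatorsII, (2.113)–(2.114) p.243] -/
theorem inner_eq_zero_of_crit [NormedAddCommGroup W] [InnerProductSpace ℝ W] (M : A →ₗ[ℝ] A) (Q : A →ₗ[ℝ] W)
    (Qs : W →ₗ[ℝ] A) (hadj : ∀ (w : W) (v : A), ⟪Qs w, v⟫_ℝ = ⟪w, Q v⟫_ℝ) (h : A) (ω : W) (hMh : M h = Qs ω)
    (v : A) (hv : Q v = 0) : ⟪v, M h⟫_ℝ = 0 := by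
  rw [hMh, real_inner_comm, hadj, hv, inner_zero_right]

/-- **The translation `A → A + H_jB`, pointwise ((2.112) ⇒ (2.113) × (2.114)):** for `M` (= Δ − ∂P_j∂*) symmetric,
`h` (= H_jB) with `Mh ⊥ {Q_jA = 0}`, any source `J′` and any `v` with `Q_jv = 0`,
`−½⟨v+h, M(v+h)⟩ + ⟨v+h, J′⟩ = (−½⟨h,Mh⟩ + ⟨h,J′⟩) + (−½⟨v,Mv⟩ + ⟨v,J′⟩)` — *"The translation gives the factor
exp[−½⟨H_jB,(Δ−∂P_j∂*)H_jB⟩ + ⟨H_jB, J − …⟩] (2.113) and separates the integral over A"*.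
[cite: Balaban1984PropagatorsII, (2.113)–(2.114) p.243] -/
theorem exponent_split_2113 [AddCommGroup W] [Module ℝ W] (M : A →ₗ[ℝ] A) (Q : A →ₗ[ℝ] W)
    (hM : ∀ x y : A, ⟪M x, y⟫_ℝ = ⟪x, M y⟫_ℝ) (h : A) (hcrit : ∀ v : A, Q v = 0 → ⟪v, M h⟫_ℝ = 0) (J' v : A)
    (hv : Q v = 0) :
    -(1 / 2) * ⟪v + h, M (v + h)⟫_ℝ + ⟪v + h, J'⟫_ℝ =
      (-(1 / 2) * ⟪h, M h⟫_ℝ + ⟪h, J'⟫_ℝ) + (-(1 / 2) * ⟪v, M v⟫_ℝ + ⟪v, J'⟫_ℝ) := by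
  have h1 : ⟪v, M h⟫_ℝ = 0 := hcrit v hv
  have h2 : ⟪h, M v⟫_ℝ = 0 := by rw [← hM, real_inner_comm, h1]
  rw [map_add, inner_add_left, inner_add_right, inner_add_right, h1, h2, inner_add_left]
  ring

variable {N : Type*} [AddCommGroup N] [Module ℝ N] [MeasurableSpace N]

/-- **(2.112) ⇒ (2.113) × (2.114), integrated:** with the fibre `{Q_jA = B}` parametrised as `ι n + h` (`ι` onto
`{Q_jA = 0}`, `h = H_jB`),
`∫dAδ(Q_jA−B) e^{−½⟨A,MA⟩+⟨A,J′⟩} = e^{−½⟨H_jB,MH_jB⟩+⟨H_jB,J′⟩} · ∫dAδ(Q_jA) e^{−½⟨A,MA⟩+⟨A,J′⟩}`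
(any measure on the parameter space; `M` symmetric, `MH_jB ⊥ {Q_jA = 0}`). [cite: Balaban1984PropagatorsII, (2.112)–(2.114) p.243] -/
theorem eq2113_2114 [AddCommGroup W] [Module ℝ W] (μ : Measure N) (ι : N →ₗ[ℝ] A) (M : A →ₗ[ℝ] A)
    (Q : A →ₗ[ℝ] W) (hM : ∀ x y : A, ⟪M x, y⟫_ℝ = ⟪x, M y⟫_ℝ) (hι : ∀ n, Q (ι n) = 0) (h : A)
    (hcrit : ∀ v : A, Q v = 0 → ⟪v, M h⟫_ℝ = 0) (J' : A) :
    ∫ n, Real.exp (-(1 / 2) * ⟪ι n + h, M (ι n + h)⟫_ℝ + ⟪ι n + h, J'⟫_ℝ) ∂μ =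
      Real.exp (-(1 / 2) * ⟪h, M h⟫_ℝ + ⟪h, J'⟫_ℝ) *
        ∫ n, Real.exp (-(1 / 2) * ⟪ι n, M (ι n)⟫_ℝ + ⟪ι n, J'⟫_ℝ) ∂μ := by
  have hfun : (fun n => Real.exp (-(1 / 2) * ⟪ι n + h, M (ι n + h)⟫_ℝ + ⟪ι n + h, J'⟫_ℝ)) =
      fun n => Real.exp (-(1 / 2) * ⟪h, M h⟫_ℝ + ⟪h, J'⟫_ℝ) *
        Real.exp (-(1 / 2) * ⟪ι n, M (ι n)⟫_ℝ + ⟪ι n, J'⟫_ℝ) := by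
    funext n
    rw [exponent_split_2113 M Q hM h hcrit J' (ι n) (hι n), Real.exp_add]
  rw [hfun, integral_const_mul]

/-- **(2.116):** `e^{−½⟨H_jB,(Δ−∂P_j∂*)H_jB⟩} · Z̃_j = ∫dAδ(Q_jA−B) e^{−½⟨A,(Δ−∂P_j∂*)A⟩}`, `Z̃_j = ∫dAδ(Q_jA) e^{−½⟨A,(Δ−∂P_j∂*)A⟩}`
— *"Let us notice also that exp[−½⟨H_jB,(Δ−∂P_j∂*)H_jB⟩] = Z̃_j⁻¹∫dAδ(Q_jA−B)exp[−½⟨A,(Δ−∂P_j∂*)A⟩] (2.116)"*.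
[cite: Balaban1984PropagatorsII, (2.116) p.243] -/
theorem eq2116 [AddCommGroup W] [Module ℝ W] (μ : Measure N) (ι : N →ₗ[ℝ] A) (M : A →ₗ[ℝ] A)
    (Q : A →ₗ[ℝ] W) (hM : ∀ x y : A, ⟪M x, y⟫_ℝ = ⟪x, M y⟫_ℝ) (hι : ∀ n, Q (ι n) = 0) (h : A)
    (hcrit : ∀ v : A, Q v = 0 → ⟪v, M h⟫_ℝ = 0) :
    ∫ n, Real.exp (-(1 / 2) * ⟪ι n + h, M (ι n + h)⟫_ℝ) ∂μ =
      Real.exp (-(1 / 2) * ⟪h, M h⟫_ℝ) * ∫ n, Real.exp (-(1 / 2) * ⟪ι n, M (ι n)⟫_ℝ) ∂μ := by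
  simpa [inner_zero_right] using eq2113_2114 μ ι M Q hM hι h hcrit 0

/-- **(2.114) = (2.115): the moment-generating function of the constrained Gaussian.**  Let `μ` be left-invariant on the
parameter space `N` of `{Q_jA = 0}` (`[MeasurableAdd N]`), `M` symmetric, and let `G̃` (= G̃_j, *"a covariance of this
Gaussian integral"*) range in `{Q_jA = 0}` (`G̃ = ι∘T`) and invert the form there (`⟨ιn, MG̃J⟩ = ⟨ιn, J⟩` for all `n`).
Then `∫dAδ(Q_jA) e^{−½⟨A,MA⟩+⟨A,J⟩} = e^{½⟨J,G̃J⟩} · Z̃_j` (translate `n → n + TJ`) — *"then the integral is equal to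
Z̃_j exp[½⟨J − …, G̃_j(J − …)⟩]. (2.115)"*. [cite: Balaban1984PropagatorsII, (2.114)–(2.115) p.243] -/
theorem eq2115 [MeasurableAdd N] (μ : Measure N) [μ.IsAddLeftInvariant] (ι : N →ₗ[ℝ] A) (M Gt : A →ₗ[ℝ] A)
    (T : A →ₗ[ℝ] N) (hM : ∀ x y : A, ⟪M x, y⟫_ℝ = ⟪x, M y⟫_ℝ) (hGt : ∀ J, Gt J = ι (T J))
    (hsol : ∀ (n : N) (J : A), ⟪ι n, M (Gt J)⟫_ℝ = ⟪ι n, J⟫_ℝ) (J : A) :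
    ∫ n, Real.exp (-(1 / 2) * ⟪ι n, M (ι n)⟫_ℝ + ⟪ι n, J⟫_ℝ) ∂μ =
      Real.exp ((1 / 2) * ⟪J, Gt J⟫_ℝ) * ∫ n, Real.exp (-(1 / 2) * ⟪ι n, M (ι n)⟫_ℝ) ∂μ := by
  have hg : ι (T J) = Gt J := (hGt J).symm
  have hgg : ⟪Gt J, M (Gt J)⟫_ℝ = ⟪Gt J, J⟫_ℝ := by
    have h0 := hsol (T J) J
    rwa [hg] at h0
  have hkey : ∀ n : N, -(1 / 2) * ⟪ι (T J + n), M (ι (T J + n))⟫_ℝ + ⟪ι (T J + n), J⟫_ℝ =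
      (1 / 2) * ⟪J, Gt J⟫_ℝ + -(1 / 2) * ⟪ι n, M (ι n)⟫_ℝ := by
    intro n
    have h1 : ⟪ι n, M (Gt J)⟫_ℝ = ⟪ι n, J⟫_ℝ := hsol n J
    have h2 : ⟪Gt J, M (ι n)⟫_ℝ = ⟪ι n, J⟫_ℝ := by rw [← hM, real_inner_comm, h1]
    rw [map_add, hg, map_add, inner_add_left, inner_add_right, inner_add_right, h1, h2, hgg, inner_add_left,
      real_inner_comm J (Gt J)]
    ring
  have hfun : (fun n => Real.exp (-(1 / 2) * ⟪ι (T J + n), M (ι (T J + n))⟫_ℝ + ⟪ι (T J + n), J⟫_ℝ)) =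
      fun n => Real.exp ((1 / 2) * ⟪J, Gt J⟫_ℝ) * Real.exp (-(1 / 2) * ⟪ι n, M (ι n)⟫_ℝ) := by
    funext n
    rw [hkey, Real.exp_add]
  calc ∫ n, Real.exp (-(1 / 2) * ⟪ι n, M (ι n)⟫_ℝ + ⟪ι n, J⟫_ℝ) ∂μ
      = ∫ n, Real.exp (-(1 / 2) * ⟪ι (T J + n), M (ι (T J + n))⟫_ℝ + ⟪ι (T J + n), J⟫_ℝ) ∂μ :=
        (integral_add_left_eq_self (fun n => Real.exp (-(1 / 2) * ⟪ι n, M (ι n)⟫_ℝ + ⟪ι n, J⟫_ℝ)) (T J)).symm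
    _ = Real.exp ((1 / 2) * ⟪J, Gt J⟫_ℝ) * ∫ n, Real.exp (-(1 / 2) * ⟪ι n, M (ι n)⟫_ℝ) ∂μ := by
        rw [hfun, integral_const_mul]

/-- **The computation (2.111):** the ω-integrals of (2.106) are two constrained Gaussians with the same covariance
`C` (= C^{(j)}_Λ, symmetric) and sources `f − g` and `f` (`f = H′_j*Δ∂*A`, `g = H′_j*∂*J`); by `eq2115` their quotient is
`e^{½⟨f−g,C(f−g)⟩ − ½⟨f,Cf⟩} = e^{−⟨f,Cg⟩ + ½⟨g,Cg⟩}` — *"Calculating these integrals we get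
exp[−⟨H′_j*Δ∂*A, C^{(j)}_ΛH′_j*∂*J⟩ + ½⟨H′_j*∂*J, C^{(j)}_ΛH′_j*∂*J⟩]"* (the exponent identity).
[cite: Balaban1984PropagatorsII, (2.111) p.242] -/
theorem eq2111_exponent {W' : Type*} [NormedAddCommGroup W'] [InnerProductSpace ℝ W'] (C : W' →ₗ[ℝ] W')
    (hC : ∀ x y : W', ⟪C x, y⟫_ℝ = ⟪x, C y⟫_ℝ) (f g : W') :
    (1 / 2) * ⟪f - g, C (f - g)⟫_ℝ - (1 / 2) * ⟪f, C f⟫_ℝ = -⟪f, C g⟫_ℝ + (1 / 2) * ⟪g, C g⟫_ℝ := by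
  have h1 : ⟪g, C f⟫_ℝ = ⟪f, C g⟫_ℝ := by rw [← hC, real_inner_comm]
  rw [map_sub, inner_sub_left, inner_sub_right, inner_sub_right, h1]
  ring

end Translation

/-! ## §5  (v1.2, append-only) The third equality of (2.106) with (2.107) `Δ′_j = H′_j*Δ²H′_j`  (r03 gen 3)
p. 242 [PDF 20], verbatim: *"= ∫dω↾_Λδ(Q′₁ω) e^{−½⟨ω,Δ′_jω⟩} e^{⟨ω, H′_j*Δ∂*A − H′_j*∂*J⟩} · (∫dω′↾_Λδ(Q′₁ω′) e^{−½⟨ω′,Δ′_jω′⟩}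
e^{⟨ω′, H′_j*Δ∂*A⟩})⁻¹, (2.106) where the second equality was obtained by the translation λ′ → λ′ + H′_jω, and the same
translation in λ, and the operator Δ′_j was defined by the second equality, Δ′_j = H′_j*Δ²H′_j. (2.107)"*.  The step from the
second member of (2.106) (exponents `−½‖ΔH′_jω‖² + ⟨ΔH′_jω, ∂*A⟩ − ⟨∂H′_jω, J⟩`, left after `exponent_split_2106`) to the
third is the regrouping below; `H′_j*` = the adjoint of `H′_j` (`hH`), `∂*` the adjoint of `∂` on vector fields (`hgrad`). -/

section Regroup

variable {B V A : Type*} [NormedAddCommGroup B] [InnerProductSpace ℝ B] [NormedAddCommGroup V]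
  [InnerProductSpace ℝ V] [NormedAddCommGroup A] [InnerProductSpace ℝ A]

/-- **(2.106) third equality / (2.107)**: `−½‖ΔH′_jω‖² + ⟨ΔH′_jω, ∂*A⟩ − ⟨∂H′_jω, J⟩
= −½⟨ω, Δ′_jω⟩ + ⟨ω, H′_j*Δ∂*A − H′_j*∂*J⟩` with `Δ′_j = H′_j*Δ²H′_j` (`lap` = Δ symmetric on scalars, `hP` = H′_j : ω ↦ λ
with adjoint `hPs` = H′_j*, `grad` = ∂ from scalars to vector fields with adjoint `dv` = ∂*; `a` = the scalar `∂*A`).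
[cite: Balaban1984PropagatorsII, (2.106)–(2.107) p.242] -/
theorem eq2106_regroup (lap : B →ₗ[ℝ] B) (hP : V →ₗ[ℝ] B) (hPs : B →ₗ[ℝ] V) (grad : B →ₗ[ℝ] A) (dv : A →ₗ[ℝ] B)
    (hlap : ∀ x y : B, ⟪lap x, y⟫_ℝ = ⟪x, lap y⟫_ℝ) (hH : ∀ (w : V) (b : B), ⟪hP w, b⟫_ℝ = ⟪w, hPs b⟫_ℝ)
    (hgrad : ∀ (b : B) (J : A), ⟪grad b, J⟫_ℝ = ⟪b, dv J⟫_ℝ) (ω : V) (a : B) (J : A) :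
    -(1 / 2) * ‖lap (hP ω)‖ ^ 2 + ⟪lap (hP ω), a⟫_ℝ - ⟪grad (hP ω), J⟫_ℝ =
      -(1 / 2) * ⟪ω, (hPs ∘ₗ lap ∘ₗ lap ∘ₗ hP) ω⟫_ℝ + ⟪ω, hPs (lap a) - hPs (dv J)⟫_ℝ := by
  have h1 : ‖lap (hP ω)‖ ^ 2 = ⟪ω, (hPs ∘ₗ lap ∘ₗ lap ∘ₗ hP) ω⟫_ℝ := by
    rw [← real_inner_self_eq_norm_sq, hlap]
    simp only [LinearMap.coe_comp, Function.comp_apply]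
    rw [hH]
  have h2 : ⟪lap (hP ω), a⟫_ℝ = ⟪ω, hPs (lap a)⟫_ℝ := by rw [hlap, hH]
  have h3 : ⟪grad (hP ω), J⟫_ℝ = ⟪ω, hPs (dv J)⟫_ℝ := by rw [hgrad, hH]
  rw [h1, h2, h3, inner_sub_right]
  ring

/-- **(2.107) is symmetric and non-negative as a form**: `⟨ω, Δ′_jω⟩ = ‖ΔH′_jω‖² ≥ 0` — the shape behind the lower/upper
bounds (2.109)–(2.110) (whose constants are `…B6Hprime2101.bound_2109`). [cite: Balaban1984PropagatorsII, (2.107) p.242] -/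
theorem inner_deltaPrimeJ_eq_norm_sq (lap : B →ₗ[ℝ] B) (hP : V →ₗ[ℝ] B) (hPs : B →ₗ[ℝ] V)
    (hlap : ∀ x y : B, ⟪lap x, y⟫_ℝ = ⟪x, lap y⟫_ℝ) (hH : ∀ (w : V) (b : B), ⟪hP w, b⟫_ℝ = ⟪w, hPs b⟫_ℝ) (ω : V) :
    ⟪ω, (hPs ∘ₗ lap ∘ₗ lap ∘ₗ hP) ω⟫_ℝ = ‖lap (hP ω)‖ ^ 2 ∧ 0 ≤ ⟪ω, (hPs ∘ₗ lap ∘ₗ lap ∘ₗ hP) ω⟫_ℝ := by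
  have h1 : ⟪ω, (hPs ∘ₗ lap ∘ₗ lap ∘ₗ hP) ω⟫_ℝ = ‖lap (hP ω)‖ ^ 2 := by
    rw [← real_inner_self_eq_norm_sq, hlap]
    simp only [LinearMap.coe_comp, Function.comp_apply]
    rw [hH]
  exact ⟨h1, h1 ▸ sq_nonneg _⟩

end Regroup

end Literature.MathematicalPhysics.QuantumFieldTheory.Balaban1983to89.B6Eq295
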